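import Mathlib

/-!
# T5TraceBaseChange — trace, norm and the trace form commute with base change

Tier-5 sub-step N2, §N2.9.2 of route/T5-N2-route-3.md (l. 63), the «completions» item: the
symplectic space `tr_{E/F}(⟨·,·⟩ ⊗ (·,·))` is used after completion at a place `v` of `F`, where
it becomes `tr_{E_v/F_v}(…)` with `E_v = E ⊗_F F_v`.  Companion of `T5BilinFormBaseChange`
(symplectic stays symplectic): here the TRACE ITSELF is shown to commute with base change, so that
the base-changed trace form IS the trace form of the base-changed algebra:

* `trace_one_tmul` / `trace_tmul`: `tr_{(L ⊗_F E)/L}(a ⊗ x) = a · tr_{E/F}(x)`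
  (Mathlib's `LinearMap.trace_baseChange` through `Algebra.baseChange_lmul`);
* `norm_one_tmul` / `norm_tmul`: the same for the norm
  (`LinearMap.det_baseChange`), `N_{(L ⊗_F E)/L}(a ⊗ x) = a^{[E:F]} · N_{E/F}(x)`;
* `traceForm_baseChange`: `(tr_{E/F}(x·y)) ⊗ L = tr_{(L ⊗_F E)/L}(x·y)` as bilinear forms on
  `L ⊗_F E`.

Everything is stated for a commutative ring `F`, an `F`-algebra `E` that is finite free over `F`
(a finite field extension in the route), and an arbitrary commutative `F`-algebra `L` (the
completion `F_v` in the route).  What stays prose: the identification `E ⊗_F F_v = ∏_{w ∣ v} E_w`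
(Kudla's splitting is a printed input; at a non-split place the tensor product is the field `E_w`).
No new definition is introduced.
-/

namespace Summit.Ventures.HodgeRepro2.T5TraceBaseChange

open TensorProduct

variable {F E L : Type*} [CommRing F] [CommRing E] [Algebra F E] [Module.Free F E]
  [Module.Finite F E] [CommRing L] [Algebra F L]

/-- The trace commutes with base change on the pure tensors `1 ⊗ x`:
`tr_{(L ⊗_F E)/L}(1 ⊗ x) = tr_{E/F}(x)` (read in `L`). -/
theorem trace_one_tmul (x : E) :
    Algebra.trace L (L ⊗[F] E) ((1 : L) ⊗ₜ[F] x) = algebraMap F L (Algebra.trace F E x) := by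
  rw [Algebra.trace_apply, Algebra.trace_apply, ← Algebra.baseChange_lmul,
    LinearMap.trace_baseChange]

omit [Module.Free F E] [Module.Finite F E] in
/-- A pure tensor is the scalar multiple of a `1 ⊗ x`: `a ⊗ x = a • (1 ⊗ x)`. -/
theorem tmul_eq_smul_one_tmul (a : L) (x : E) :
    a ⊗ₜ[F] x = a • ((1 : L) ⊗ₜ[F] x) := by
  rw [TensorProduct.smul_tmul', smul_eq_mul, mul_one]

/-- The trace commutes with base change: `tr_{(L ⊗_F E)/L}(a ⊗ x) = a · tr_{E/F}(x)`. -/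
theorem trace_tmul (a : L) (x : E) :
    Algebra.trace L (L ⊗[F] E) (a ⊗ₜ[F] x) = a * algebraMap F L (Algebra.trace F E x) := by
  rw [tmul_eq_smul_one_tmul, map_smul, trace_one_tmul, smul_eq_mul]

/-- The norm commutes with base change on the pure tensors `1 ⊗ x`:
`N_{(L ⊗_F E)/L}(1 ⊗ x) = N_{E/F}(x)` (read in `L`). -/
theorem norm_one_tmul (x : E) :
    Algebra.norm L ((1 : L) ⊗ₜ[F] x) = algebraMap F L (Algebra.norm F x) := by
  rw [Algebra.norm_apply, Algebra.norm_apply, ← Algebra.baseChange_lmul, LinearMap.det_baseChange]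

/-- The norm commutes with base change: `N_{(L ⊗_F E)/L}(a ⊗ x) = a^{[L ⊗_F E : L]} · N_{E/F}(x)`
(the norm is multiplicative and `a = algebraMap L (L ⊗_F E) a` has norm `a ^ rank`). -/
theorem norm_tmul (a : L) (x : E) :
    Algebra.norm L (a ⊗ₜ[F] x) =
      a ^ Module.finrank L (L ⊗[F] E) * algebraMap F L (Algebra.norm F x) := by
  rw [tmul_eq_smul_one_tmul, Algebra.smul_def, map_mul, Algebra.norm_algebraMap, norm_one_tmul]

/-- `norm_tmul` with the rank read over `F`: for nontrivial `F` and `L` (fields in the route),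
`N_{(L ⊗_F E)/L}(a ⊗ x) = a^{[E:F]} · N_{E/F}(x)`. -/
theorem norm_tmul' [Nontrivial F] [Nontrivial L] (a : L) (x : E) :
    Algebra.norm L (a ⊗ₜ[F] x) = a ^ Module.finrank F E * algebraMap F L (Algebra.norm F x) := by
  rw [norm_tmul, Module.finrank_baseChange]

/-- The base change of the trace form of `E / F` is the trace form of `(L ⊗_F E) / L`:
`(x, y) ↦ tr_{E/F}(x y)` base-changed to `L` is `(x, y) ↦ tr_{(L ⊗_F E)/L}(x y)`. -/
theorem traceForm_baseChange :
    (Algebra.traceForm F E).baseChange L = Algebra.traceForm L (L ⊗[F] E) := by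
  apply TensorProduct.AlgebraTensorModule.ext
  intro a x
  apply TensorProduct.AlgebraTensorModule.ext
  intro b y
  rw [LinearMap.BilinForm.baseChange_tmul, Algebra.traceForm_apply, Algebra.traceForm_apply,
    Algebra.TensorProduct.tmul_mul_tmul, trace_tmul, Algebra.smul_def, mul_comm]

/-- Pointwise form of `traceForm_baseChange`. -/
theorem traceForm_baseChange_apply (x y : L ⊗[F] E) :
    (Algebra.traceForm F E).baseChange L x y = Algebra.trace L (L ⊗[F] E) (x * y) := by
  rw [traceForm_baseChange, Algebra.traceForm_apply]

end Summit.Ventures.HodgeRepro2.T5TraceBaseChange
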